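import Summits.CriticalPhenomena.CardyFormulaZ2.Theorems.CardySelfRefinementCriticalPathRSW
import Summits.CriticalPhenomena.CardyFormulaZ2.Theorems.CardySelfRefinementDefs
import Literature.Probability.Percolation.ZdFourArmSeparated
import HarnessLib

/-!
# F3 WITNESS — `Rung 1` IS the floor `CriticalPathRSW` (seed theorem `CriticalPathRSW_proof`)

Published as `Cruxes/TrivialSectorRate/Lines/arm_separation_rung_special.lean` next to the line skeleton
`Cruxes/TrivialSectorRate/Lines/arm_separation_rung.lean` (rung-harvest `fwd-harvest-CriticalPhenomena-04`,
source seat `fwd-rung-CriticalPhenomena-04`).  Self-contained so that it re-elaborates standalone: §1 below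
is the line file's §1 VERBATIM — same namespace, same bodies (`FourArmSeparationAlong`, `Rung`); do not
import this file together with the line file (duplicate declarations) — import the line file and use its
`floor_pathOK` / `criticalPathRSW_of_rung` instead, the witness proof below goes through unchanged.

At horizon `L = 1` the scale clause `2n ≤ N ≤ 1·n` (with `n ≥ n₀ := 1`) is empty, so `Rung 1`
specialises to the proved floor (six-line proof from the seed theorem through the definitional
bridge `criticalPathRSW_iff`); conversely `Rung L → CriticalPathRSW` for every `L` is the first
conjunct.  No `sorry` in this file.
-/

noncomputable section

namespace Summit.CriticalPhenomena.CardyFormulaZ2.Cruxes.TrivialSectorRate.ArmSeparationRung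

open Set MeasureTheory
open Literature.Probability.LatticeModels Literature.Probability.Percolation
open Summit.CriticalPhenomena.CardyFormulaZ2.Theorems
open Summit.CriticalPhenomena.CardyFormulaZ2.Theorems.CardySelfRefinement

/-! ## §1 (verbatim from `Sketch.lean` §1) -/

/-- **Four-arm separation along `γ` up to scale-ratio horizon `L`.** -/
def FourArmSeparationAlong (k : ℕ) (γ : unitInterval → ℝ × ℝ) (L : ℕ∞) : Prop :=
  ∃ n₀ : ℕ, ∃ c : ℝ, 0 < c ∧ ∀ (s : unitInterval) (n N : ℕ), n₀ ≤ n → 2 * n ≤ N →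
    (N : ℕ∞) ≤ L * (n : ℕ∞) →
      c * (M k (γ s).1 (γ s).2).real (fourArmTwoClusters n N) ≤
        (M k (γ s).1 (γ s).2).real (zdFourArmSep n N)

/-- **The graded family `Rung L`.** -/
def Rung (L : ℕ∞) : Prop :=
  ∀ k : ℕ, k = 2 ∨ k = 3 →
    (∃ γ : unitInterval → ℝ × ℝ, PathOK k γ) ∧
      ∀ γ : unitInterval → ℝ × ℝ, PathOK k γ → FourArmSeparationAlong k γ L

/-! ## §2 The witness -/

/-- The floor in `PathOK` form, from the seed theorem (definitional bridge `criticalPathRSW_iff`). -/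
theorem floor_pathOK : ∀ k : ℕ, k = 2 ∨ k = 3 → ∃ γ : unitInterval → ℝ × ℝ, PathOK k γ :=
  criticalPathRSW_iff.mp CriticalPathRSW_proof

/-- **F3 witness**: the rung at the floor's parameter `L = 1`, from the seed theorem. -/
theorem rung_one : Rung 1 := by
  intro k hk
  refine ⟨floor_pathOK k hk, fun γ _ => ⟨1, 1, one_pos, fun s n N hn hnN hL => ?_⟩⟩
  exfalso
  have hL' : N ≤ n := by exact_mod_cast (by simpa using hL : (N : ℕ∞) ≤ (n : ℕ∞))
  omega

/-- The `simpa using` form asked by FORWARD DISCIPLINE F3 (up to the vacuous scale clause). -/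
example : Rung 1 := by simpa using rung_one

/-- Converse direction (informational): every rung contains the floor, so `Rung 1 ↔ floor`. -/
theorem criticalPathRSW_of_rung (L : ℕ∞) (h : Rung L) :
    Summit.CriticalPhenomena.CardyFormulaZ2.Theses.CardySelfRefinement.CriticalPathRSW :=
  criticalPathRSW_iff.mpr fun k hk => (h k hk).1

theorem rung_one_iff_floor :
    Rung 1 ↔ Summit.CriticalPhenomena.CardyFormulaZ2.Theses.CardySelfRefinement.CriticalPathRSW :=
  ⟨criticalPathRSW_of_rung 1, fun _ => rung_one⟩

end Summit.CriticalPhenomena.CardyFormulaZ2.Cruxes.TrivialSectorRate.ArmSeparationRung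

end
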